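import Summits.CriticalPhenomena.PercolationContinuityZ3.Theorems.PercNearOneGluingNoHeavyLowerTailIncStarTwoCutFYCertData1
import Summits.CriticalPhenomena.PercolationContinuityZ3.Theorems.PercNearOneGluingNoHeavyLowerTailIncStarTwoCutFYCertData2
import Summits.CriticalPhenomena.PercolationContinuityZ3.Theorems.PercNearOneGluingNoHeavyLowerTailIncStarTwoCutFYCertTargetPos
import Summits.CriticalPhenomena.PercolationContinuityZ3.Theorems.PercNearOneGluingNoHeavyLowerTailIncStarTwoCutFYCertTargetNeg
import HarnessLib

/-!
# MODE B, XVI: the (FY) certificate identity, checked (COMPUTATIONAL: one `native_decide`)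

Support file for the Sahi programme (`--supports stmt-CriticalPhenomena-4575`, prover prim-sahi-p2 gen 27).  `fy_cert_checkN`: the normal forms of
`D·(FY)` (`fyTargetPos/Neg`, D = 144432) and of `Σ_blocks mult·row` (`fyBlocks`, 168 rows, 4960 multiplier terms: four-functions / BHK 1.1 rows as
`prod` masks, the two far stars and `σ·Cov(B_∪,C_∪)` as `e3` masks, nonnegative monomials, `c_q` multipliers) coincide — evaluated by `native_decide` exactly like
`…CubicFourPointL1Cert` (computational ancestry `Lean.ofReduceBool`).  By `denote_eq_of_fcheckN` the identity holds in `ℝ`; the SEMANTIC discharge (each `prod` row an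
instance of `prodBernoulli_fourEvents` / `bhk_thm_1_1` on the far cells of the two-cut, the two far stars as inductive hypotheses, `c_q ≥ 0` by Harris on the class law)
and the assembly into `hFX` of `incStar_nonneg_of_twoCut_rootSideTarget_of_FX` are the successor's files.  Memo §11–§13, PROOF-E3 (37l).
-/

namespace Summit.CriticalPhenomena.PercolationContinuityZ3.Theorems

namespace IncStarTwoCut.FXCert

open Lean.Grind.CommRing FourPointCert

/-- All certificate blocks of (FY). [this work] -/
def fyBlocks : List FBlock := fyBlocks1 ++ fyBlocks2

set_option maxRecDepth 100000 in
/-- **The (FY) certificate identity** `D·(FY) = Σ_blocks mult·row` (COMPUTATIONAL: `native_decide`). [this work] -/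
theorem fy_cert_checkN : fcheckN fyTargetPos fyTargetNeg fyBlocks = true := by
  native_decide

end IncStarTwoCut.FXCert

end Summit.CriticalPhenomena.PercolationContinuityZ3.Theorems
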